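import Literature.MathematicalPhysics.QuantumFieldTheory.BlochPeriodicCochains
import HarnessLib

/-!
# The discrete Poincaré lemma on the torus `(ℤ/L)^d` with coefficients in ANY additive group: a closed
# lattice 1-cochain is a coboundary plus a combination of the `d` coordinate SHEETS, read off by its
# cycle holonomies (gauge-boot, L3 structural supplement; torus tools)

HONEST FRAMING (cell `pub-gaugeboot`, page 1 of every file): the venture produces certified bounds
on lattice expectations at stated coupling, gauge group, dimension and torus size; NOT a mass gap,
NOT a continuum limit, NOT a string tension; NOT Yang–Mills-summit-bearing (barriers
`FixedCouplingUltralocality`, `PerturbativeInvisibility`). This module bounds no expectation: it is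
lattice combinatorics, used by the sequel `TorusKSCochains.lean` (the `2^d` gauge classes of
Kogut–Susskind staggerings of the even torus, with `ℤ/2` coefficients).

The tree's `LatticeForm` (`Literature…BlochPeriodicCochains`) proves `H¹` of the discrete torus over a
FIELD in which `L ≠ 0`: a closed `1`-cochain is a CONSTANT cochain plus a coboundary
(`exists_const_add_td₀`, cycle averages `L⁻¹ ∑`). For the staggerings one needs `ℤ/2` coefficients on a
torus of EVEN side, where `L = 0` in the coefficients: a constant cochain is then itself a coboundary
(its cycle sums `L·c` vanish) and cannot represent `H¹`. The integral statement, valid in every additive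
commutative group `A` and for every `L ≥ 1`, replaces the constants by the coordinate SHEETS:

* `IsClosed θ` — vanishing plaquette sums (`= (LatticeForm.td₁ θ = 0)` of `AbelianTorusCochains`, not
  imported); `isClosed_td₀`; `cycleHolonomy θ m = ∑_{t<L} θ(t e_m; m)` — the sum once around the
  coordinate cycle through `0` in direction `m`; `cycleHolonomy_td₀ = 0`;
* `sheet m a (y; i) = [i = m, y_m = -1] · a` — the cochain supported on the layer of `m`-links from
  `x_m = L - 1` to `x_m = 0`; `isClosed_sheet`, `cycleHolonomy_sheet = [m' = m] · a`;
* the pullback `θ ∘ Torus.proj L` to `ℤ^d` is closed and `L ℤ^d`-periodic; for a primitive `Φ` of it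
  (`LatticeForm.exists_d₀_eq_of_d₁_eq_zero`): `apply_add_period_single` — **`Φ(x + L e_m) = Φ(x) +
  cycleHolonomy θ m`** (`LatticeForm.apply_add_period` + `sub_eq_sum_d₀`), and
  `apply_add_zsmul_of_cycleHolonomy_eq_zero` — vanishing holonomies make `Φ` periodic;
* ★★ `exists_td₀_of_cycleHolonomy_eq_zero` — **a closed cochain all of whose `d` cycle holonomies vanish
  is a coboundary `td₀ φ`** (the periodic primitive descends through `LatticeForm.repZ`), ★★
  `exists_eq_td₀_add_sheets` — **every closed cochain is `td₀ φ + ∑_m sheet m (cycleHolonomy θ m)`**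
  (`H¹((ℤ/L)^d; A) ≅ A^d` by the cycle holonomies), `exists_td₀_iff`;
* `eq_of_td₀_eq_zero` — `H⁰`: vanishing coboundary means constant (`L ≥ 1`).

[folklore] bookkeeping (cellular cohomology of the torus; on the lattice: flux sectors / twisted
boundary conditions, G. 't Hooft, Nucl. Phys. B 153 (1979) 141). No measure, no bound.
-/

namespace Summit.QuantumFields.GaugeBoot

open Literature.Probability.LatticeModels (Site TorusSite Torus.proj Torus.proj_apply)
open Literature.MathematicalPhysics.QuantumFieldTheory (LatticeForm.td₀ LatticeForm.repZ LatticeForm.e)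
open Literature.MathematicalPhysics.QuantumFieldTheory.LatticeForm (d₀ d₁ proj_repZ proj_add_zsmul
  proj_add_e exists_eq_add_zsmul_of_proj_eq exists_d₀_eq_of_d₁_eq_zero eq_of_d₀_eq_zero IsBloch defect
  apply_add_period sub_eq_sum_d₀)

namespace TorusPoincare

variable {d L : ℕ} {A : Type*} [AddCommGroup A]

/-! ## Closed cochains, cycle holonomies and sheets on the torus -/

/-- `td₀` evaluated. -/
theorem td₀_apply (φ : TorusSite d L → A) (y : TorusSite d L) (i : Fin d) :
    LatticeForm.td₀ φ y i = φ (y + Pi.single i 1) - φ y := rfl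

/-- **Closed `1`-cochains** of the torus: vanishing plaquette sums
`θ(y;i) + θ(y+eᵢ;j) - θ(y+eⱼ;i) - θ(y;j) = 0` (the formula of `LatticeForm.td₁ θ = 0`). [shape] A
hypothesis (a `Prop`), asserting nothing. [folklore] -/
def IsClosed (θ : TorusSite d L → Fin d → A) : Prop :=
  ∀ (y : TorusSite d L) (i j : Fin d),
    θ y i + θ (y + Pi.single i 1) j - θ (y + Pi.single j 1) i - θ y j = 0

/-- **Coboundaries are closed.** -/
theorem isClosed_td₀ (φ : TorusSite d L → A) : IsClosed (LatticeForm.td₀ φ) := by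
  intro y i j
  simp only [td₀_apply, add_right_comm y (Pi.single i (1 : ZMod L)) (Pi.single j 1)]
  abel

/-- Closed cochains: sums. -/
theorem IsClosed.add {θ θ' : TorusSite d L → Fin d → A} (h : IsClosed θ) (h' : IsClosed θ') :
    IsClosed (θ + θ') := by
  intro y i j
  have h1 := h y i j; have h2 := h' y i j
  simp only [Pi.add_apply]
  calc θ y i + θ' y i + (θ (y + Pi.single i 1) j + θ' (y + Pi.single i 1) j) -
        (θ (y + Pi.single j 1) i + θ' (y + Pi.single j 1) i) - (θ y j + θ' y j)
      = (θ y i + θ (y + Pi.single i 1) j - θ (y + Pi.single j 1) i - θ y j) +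
          (θ' y i + θ' (y + Pi.single i 1) j - θ' (y + Pi.single j 1) i - θ' y j) := by abel
    _ = 0 := by rw [h1, h2, add_zero]

/-- Closed cochains: negation. -/
theorem IsClosed.neg {θ : TorusSite d L → Fin d → A} (h : IsClosed θ) : IsClosed (-θ) := by
  intro y i j
  have h1 := h y i j
  simp only [Pi.neg_apply]
  calc -θ y i + -θ (y + Pi.single i 1) j - -θ (y + Pi.single j 1) i - -θ y j
      = -(θ y i + θ (y + Pi.single i 1) j - θ (y + Pi.single j 1) i - θ y j) := by abel
    _ = 0 := by rw [h1, neg_zero]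

/-- Closed cochains: differences. -/
theorem IsClosed.sub {θ θ' : TorusSite d L → Fin d → A} (h : IsClosed θ) (h' : IsClosed θ') :
    IsClosed (θ - θ') := by
  rw [sub_eq_add_neg]; exact h.add h'.neg

/-- Closed cochains: finite sums. -/
theorem isClosed_sum {ι : Type*} (s : Finset ι) {θ : ι → TorusSite d L → Fin d → A}
    (h : ∀ a ∈ s, IsClosed (θ a)) : IsClosed (∑ a ∈ s, θ a) := by
  classical
  induction s using Finset.induction_on with
  | empty => intro y i j; simp
  | insert a s ha ih =>
    rw [Finset.sum_insert ha]
    exact (h a (Finset.mem_insert_self a s)).add (ih fun b hb => h b (Finset.mem_insert_of_mem hb))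

/-- **The cycle holonomy** of a `1`-cochain around the coordinate cycle through `0` in direction `m`:
`∑_{t<L} θ(t e_m; m)`. -/
def cycleHolonomy (θ : TorusSite d L → Fin d → A) (m : Fin d) : A :=
  ∑ t ∈ Finset.range L, θ (Pi.single m (t : ZMod L)) m

/-- The cycle holonomy is additive. -/
theorem cycleHolonomy_add (θ θ' : TorusSite d L → Fin d → A) (m : Fin d) :
    cycleHolonomy (θ + θ') m = cycleHolonomy θ m + cycleHolonomy θ' m := by
  simp [cycleHolonomy, Finset.sum_add_distrib]

/-- The cycle holonomy of a negated cochain. -/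
theorem cycleHolonomy_neg (θ : TorusSite d L → Fin d → A) (m : Fin d) :
    cycleHolonomy (-θ) m = -cycleHolonomy θ m := by
  simp [cycleHolonomy, Finset.sum_neg_distrib]

/-- The cycle holonomy of a finite sum. -/
theorem cycleHolonomy_sum {ι : Type*} (s : Finset ι) (θ : ι → TorusSite d L → Fin d → A) (m : Fin d) :
    cycleHolonomy (∑ a ∈ s, θ a) m = ∑ a ∈ s, cycleHolonomy (θ a) m := by
  simp only [cycleHolonomy, Finset.sum_apply]
  rw [Finset.sum_comm]

/-- **Coboundaries have zero cycle holonomy** (the sum telescopes around the cycle). -/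
theorem cycleHolonomy_td₀ (φ : TorusSite d L → A) (m : Fin d) :
    cycleHolonomy (LatticeForm.td₀ φ) m = 0 := by
  unfold cycleHolonomy
  have h : ∀ t : ℕ, LatticeForm.td₀ φ (Pi.single m (t : ZMod L)) m =
      φ (Pi.single m ((t + 1 : ℕ) : ZMod L)) - φ (Pi.single m (t : ZMod L)) := by
    intro t
    rw [td₀_apply, ← Pi.single_add, Nat.cast_succ]
  simp only [h, Finset.sum_range_sub (fun t => φ (Pi.single m (t : ZMod L))), Nat.cast_zero,
    ZMod.natCast_self, sub_self]

/-- **The coordinate sheet** in direction `m` with value `a`: the `1`-cochain equal to `a` on the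
`m`-links from the layer `x_m = -1 (= L - 1)` to the layer `x_m = 0`, and `0` elsewhere. -/
def sheet (m : Fin d) (a : A) : TorusSite d L → Fin d → A :=
  fun y i => if i = m ∧ y m + 1 = 0 then a else 0

/-- `sheet` evaluated. -/
theorem sheet_apply (m : Fin d) (a : A) (y : TorusSite d L) (i : Fin d) :
    sheet m a y i = if i = m ∧ y m + 1 = 0 then a else 0 := rfl

/-- **Sheets are closed** (a plaquette in a plane containing `m` meets the sheet in zero or two
`m`-links with opposite orientations; other plaquettes do not meet it). -/
theorem isClosed_sheet (m : Fin d) (a : A) : IsClosed (sheet (L := L) m a) := by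
  intro y i j
  simp only [sheet_apply, Pi.add_apply, Pi.single_apply]
  by_cases hj : j = m
  · subst hj
    by_cases hi : i = j
    · subst hi; simp
    · simp [hi, Ne.symm hi]
  · by_cases hi : i = m
    · subst hi
      simp [hj, Ne.symm hj]
    · simp [hi, hj]

/-- **The cycle holonomies of a sheet**: `a` around the cycle in its own direction, `0` around the
others (`L ≥ 1`). -/
theorem cycleHolonomy_sheet [NeZero L] (m m' : Fin d) (a : A) :
    cycleHolonomy (sheet (L := L) m a) m' = if m' = m then a else 0 := by
  unfold cycleHolonomy
  by_cases hm : m' = m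
  · subst hm
    simp only [sheet_apply, Pi.single_eq_same, true_and, if_true]
    -- exactly the term `t = L - 1` survives
    have hL : L - 1 + 1 = L := Nat.sub_add_cancel (Nat.one_le_iff_ne_zero.2 (NeZero.ne L))
    have hlast : ((L - 1 : ℕ) : ZMod L) + 1 = 0 := by
      have h' : ((L - 1 + 1 : ℕ) : ZMod L) = 0 := by rw [hL, ZMod.natCast_self]
      exact_mod_cast h'
    rw [Finset.sum_eq_single (L - 1), if_pos hlast]
    · intro t ht hne
      rw [if_neg]
      intro h
      have h' : ((t + 1 : ℕ) : ZMod L) = 0 := by exact_mod_cast h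
      rw [ZMod.natCast_eq_zero_iff] at h'
      have := Nat.le_of_dvd (Nat.succ_pos t) h'
      rw [Finset.mem_range] at ht
      exact hne (by omega)
    · intro h
      exact absurd (Finset.mem_range.2 (by omega)) h
  · rw [if_neg hm]
    exact Finset.sum_eq_zero fun t _ => by rw [sheet_apply, if_neg (fun h => hm h.1)]

/-! ## The pullback to `ℤ^d` and its primitive -/

/-- The torus site `t e_m` is the projection of the `ℤ^d` site `t e_m`. -/
theorem torusProj_zsmul_e (m : Fin d) (t : ℤ) :
    Torus.proj L (t • (LatticeForm.e m : Site d)) = Pi.single m (t : ZMod L) := by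
  funext i
  by_cases hi : i = m
  · subst hi; simp [LatticeForm.e]
  · simp [LatticeForm.e, Pi.single_eq_of_ne hi]

/-- **The pullback of a closed torus cochain to `ℤ^d` is closed.** -/
theorem d₁_pull_eq_zero {θ : TorusSite d L → Fin d → A} (h : IsClosed θ) :
    d₁ (fun x => θ (Torus.proj L x)) = 0 := by
  funext x i j
  simp only [d₁, proj_add_e, Pi.zero_apply]
  exact h _ i j

/-- The pullback is `L ℤ^d`-periodic (`1`-Bloch). -/
theorem isBloch_pull (θ : TorusSite d L → Fin d → A) :
    IsBloch L (fun _ => (1 : ℤ)) (fun x : Site d => θ (Torus.proj L x)) := by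
  intro x a
  simp only [proj_add_zsmul, one_smul]

/-- ★ **The period of a primitive along `L e_m` is the cycle holonomy**: if `d₀ Φ` is the pullback of
`θ`, then `Φ(x + L e_m) = Φ(x) + cycleHolonomy θ m` for every `x` (the period defect is constant by
`LatticeForm.apply_add_period`, and at `x = 0` it is the line sum `LatticeForm.sub_eq_sum_d₀`). -/
theorem apply_add_period_single {θ : TorusSite d L → Fin d → A} {Φ : Site d → A}
    (hΦ : d₀ Φ = fun x => θ (Torus.proj L x)) (m : Fin d) (x : Site d) :
    Φ (x + (L : ℤ) • (LatticeForm.e m : Site d)) = Φ x + cycleHolonomy θ m := by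
  have hB : IsBloch L (fun _ => (1 : ℤ)) (d₀ Φ) := by rw [hΦ]; exact isBloch_pull θ
  rw [apply_add_period hB (LatticeForm.e m) x, one_smul]
  congr 1
  -- the defect at `0` is the line sum of `d₀ Φ` along the cycle
  have h := sub_eq_sum_d₀ Φ 0 m L
  simp only [zero_add, hΦ, torusProj_zsmul_e, Int.cast_natCast] at h
  simp only [defect, one_smul, zero_add]
  exact h

/-- **Vanishing holonomies make every primitive of the pullback `L ℤ^d`-periodic.** -/
theorem apply_add_zsmul_of_cycleHolonomy_eq_zero {θ : TorusSite d L → Fin d → A} {Φ : Site d → A}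
    (hΦ : d₀ Φ = fun x => θ (Torus.proj L x)) (h0 : ∀ m, cycleHolonomy θ m = 0) (x a : Site d) :
    Φ (x + (L : ℤ) • a) = Φ x := by
  -- `q ↦ Φ(x + L q)` has zero coboundary, hence is constant
  have hd : d₀ (fun q : Site d => Φ (x + (L : ℤ) • q)) = 0 := by
    funext q m
    simp only [d₀, Pi.zero_apply, smul_add, ← add_assoc, apply_add_period_single hΦ m, h0 m, add_zero,
      sub_self]
  have h := eq_of_d₀_eq_zero hd a 0
  simpa using h

/-! ## The torus Poincaré lemma -/

/-- ★★ **The torus Poincaré lemma**: a closed `1`-cochain on `(ℤ/L)^d` all of whose `d` cycle holonomies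
vanish is a coboundary (the primitive of its pullback is periodic and descends through the integer
representatives `LatticeForm.repZ`). -/
theorem exists_td₀_of_cycleHolonomy_eq_zero [NeZero L] {θ : TorusSite d L → Fin d → A}
    (h : IsClosed θ) (h0 : ∀ m, cycleHolonomy θ m = 0) :
    ∃ φ : TorusSite d L → A, LatticeForm.td₀ φ = θ := by
  obtain ⟨Φ, hΦ⟩ := exists_d₀_eq_of_d₁_eq_zero _ (d₁_pull_eq_zero h)
  refine ⟨fun y => Φ (LatticeForm.repZ y), funext fun y => funext fun i => ?_⟩
  -- `θ y i = d₀ Φ (repZ y) i = Φ (repZ y + eᵢ) - Φ (repZ y)`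
  have h1 : θ y i = d₀ Φ (LatticeForm.repZ y) i := by
    rw [hΦ]; simp only [proj_repZ]
  -- the two lifts of `y + eᵢ` differ by a period
  have h3 : Torus.proj L (LatticeForm.repZ y + LatticeForm.e i) =
      Torus.proj L (LatticeForm.repZ (y + Pi.single i 1)) := by
    rw [proj_add_e, proj_repZ, proj_repZ]
  obtain ⟨a, ha⟩ := exists_eq_add_zsmul_of_proj_eq h3
  have h4 : Φ (LatticeForm.repZ (y + Pi.single i 1)) = Φ (LatticeForm.repZ y + LatticeForm.e i) := by
    rw [ha, apply_add_zsmul_of_cycleHolonomy_eq_zero hΦ h0]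
  rw [td₀_apply, h1, h4]
  rfl

/-- ★★ **`H¹((ℤ/L)^d; A) ≅ A^d` by the cycle holonomies**: every closed `1`-cochain is a coboundary
plus the combination `∑_m sheet m (cycleHolonomy θ m)` of the coordinate sheets. -/
theorem exists_eq_td₀_add_sheets [NeZero L] {θ : TorusSite d L → Fin d → A} (h : IsClosed θ) :
    ∃ φ : TorusSite d L → A, θ = LatticeForm.td₀ φ + ∑ m, sheet m (cycleHolonomy θ m) := by
  classical
  set s : TorusSite d L → Fin d → A := ∑ m, sheet m (cycleHolonomy θ m) with hs
  have hsc : IsClosed s := isClosed_sum _ fun m _ => isClosed_sheet m _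
  have hhol : ∀ m, cycleHolonomy (θ - s) m = 0 := by
    intro m
    rw [sub_eq_add_neg, cycleHolonomy_add, cycleHolonomy_neg, hs, cycleHolonomy_sum]
    simp only [cycleHolonomy_sheet, Finset.sum_ite_eq, Finset.mem_univ, if_true, add_neg_cancel]
  obtain ⟨φ, hφ⟩ := exists_td₀_of_cycleHolonomy_eq_zero (h.sub hsc) hhol
  exact ⟨φ, by rw [hφ, sub_add_cancel]⟩

/-- **A closed cochain is a coboundary iff its cycle holonomies vanish.** -/
theorem exists_td₀_iff [NeZero L] {θ : TorusSite d L → Fin d → A} (h : IsClosed θ) :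
    (∃ φ : TorusSite d L → A, LatticeForm.td₀ φ = θ) ↔ ∀ m, cycleHolonomy θ m = 0 := by
  refine ⟨?_, exists_td₀_of_cycleHolonomy_eq_zero h⟩
  rintro ⟨φ, rfl⟩ m
  exact cycleHolonomy_td₀ φ m

/-! ## `H⁰`: vanishing coboundary means constant -/

/-- **A `0`-cochain on the torus with vanishing coboundary is constant** (`L ≥ 1`; pull back to `ℤ^d`
and use `LatticeForm.eq_of_d₀_eq_zero`). -/
theorem eq_of_td₀_eq_zero [NeZero L] {φ : TorusSite d L → A}
    (h : LatticeForm.td₀ φ = 0) (y y' : TorusSite d L) : φ y = φ y' := by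
  have hd : d₀ (fun x : Site d => φ (Torus.proj L x)) = 0 := by
    funext x i
    have h1 := congrFun (congrFun h (Torus.proj L x)) i
    simp only [td₀_apply, Pi.zero_apply] at h1
    simp only [d₀, proj_add_e, Pi.zero_apply]
    exact h1
  have h2 := eq_of_d₀_eq_zero hd (LatticeForm.repZ y) (LatticeForm.repZ y')
  simpa [proj_repZ] using h2

/-- **Two `0`-cochains with the same coboundary differ by a constant.** -/
theorem eq_add_const_of_td₀_eq [NeZero L] {φ ψ : TorusSite d L → A}
    (h : LatticeForm.td₀ φ = LatticeForm.td₀ ψ) (y : TorusSite d L) : φ y = ψ y + (φ 0 - ψ 0) := by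
  have h0 : LatticeForm.td₀ (φ - ψ) = 0 := by
    funext x i
    have h1 := congrFun (congrFun h x) i
    simp only [td₀_apply] at h1
    simp only [td₀_apply, Pi.sub_apply, Pi.zero_apply]
    rw [sub_sub_sub_comm, h1, sub_self]
  have h2 := eq_of_td₀_eq_zero h0 y 0
  simp only [Pi.sub_apply] at h2
  rw [← h2, add_sub_cancel]

end TorusPoincare

end Summit.QuantumFields.GaugeBoot
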